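import Literature.IUT.HodgeTheaters.PMBaseBridgeProps
import Literature.IUT.HodgeTheaters.ThetaNFKit

/-!
# [IUTchI] §6, Definition 6.11, Corollary 6.12, Remarks 6.12.1–6.12.2, Definition 6.13: `Θ^{±ell}`- and `Θ^{±ell}NF`-Hodge theaters

Mochizuki, *Inter-universal Teichmüller theory I*, §6: Definition 6.11 (i)–(iii) pp. 172–173, Corollary
6.12 (i), (ii) p. 173, Remark 6.12.1 p. 174, Remark 6.12.2 (i), (ii) pp. 174–175, Definition 6.13 (i),
(ii) pp. 182–183, kurims manuscript (May 2020) ([IUTchI] Def 6.11-6.13 pp.172-183) [claim: Mochizuki2012, status: disputed].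

The Frobenioid-theoretic lifts of the base bridges of Definition 6.4, over the `ℱ`-prime-strips of
`FPrimeStrips.lean` (interface `FKit`) and the base bridges of `PMBaseBridges.lean`; the ΘNF-side
objects of Def 6.13 (ΘNF-Hodge theaters, abc-iut-L5-t3's Def 5.5) enter through the hypothesis kit
`S5Local` of `ThetaNFKit.lean` (TODO-merge:abc-iut-L5-t3):

* Def 6.11 (i) Θ^±-bridges `†ψ^{Θ±}_± : †𝔉_T → †𝔉_≻` lifting a `𝒟-Θ^±`-bridge (Cor 5.3 (ii)), the
  capsules `†𝔉_{|T|}`, `†𝔉_{T^⋇}`, isomorphisms; (ii) Θ^{ell}-bridges `†ψ^{Θell}_± : †𝔉_T → †𝒟^{⊚±}` ("where …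
  `†𝔇_T` [is] the capsule of `𝒟`-prime-strips associated to `†𝔉_T`") = a `𝒟-Θ^{ell}`-bridge on the
  associated capsule, isomorphisms; (iii) Θ^{±ell}-Hodge theaters and isomorphisms;
* Cor 6.12 (i), (ii) as theorems over the rendering (the lift maps are identities; (ii) = Prop 6.6
  (iv) for the base bridges); Rmk 6.12.1 (functorial dynamics) as a statement schema; Rmk 6.12.2 (i)
  "the Θ-bridge is glued to the Θ^±-bridge via the functorial algorithm of Proposition 6.7" (index
  bijection + compatibility of the FULL poly-isomorphisms), (ii) uniqueness of the gluing (named);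
* Def 6.13 (i) Θ^{±ell}NF-Hodge theaters `†ℋ𝒯^{Θ±ellNF}` ("a triple … (a) a Θ^{±ell}-Hodge theater; (b) a
  ΘNF-Hodge theater; (c) the [necessarily unique!] gluing isomorphism"), (ii) `𝒟-Θ^{±ell}NF`-Hodge
  theaters.

Remarks 6.12.3–6.12.6 (pp. 175–182; typed by abc-iut-L5-t6/t7 in `PMTheatersRemarksA/B.lean`) are
expository (analogies with the upper half-plane, the roles of the `𝔽_l^{⋊±}`- and `𝔽_l^⋇`-symmetries;
Figs. 6.4–6.6); summary: 6.12.3 the two symmetries as "two combinatorial dimensions"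
(additive `z ↦ ±z + a` / multiplicative toral symmetries of `ℌ`, cusp vs node prototypes, coric
symmetry `{±1}`); 6.12.4 the symmetries will give "an explicit network of comparison isomorphisms …
without label crushing", realised by the bijections `†ζ_⋇`, `†ζ_±`, constructed "by means of
functorial algorithms from the intrinsic structure", and the global `±`-synchronization `†ξ`; 6.12.5
the inclusion of the zero label in the `𝔽_l^{⋊±}`-symmetry (relating zero-labeled and nonzero-labeled
prime-strips; Gaussian Frobenioids need both structures; no additive analogue of Example 5.1 is
required); 6.12.6 the geometric vs arithmetic nature of the single basepoints (`𝕍^±` vs the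
`𝔽_l^⋇`-translates of `𝕍^{±un}`; the Borel subgroup is normally terminal in `SL₂(𝔽_l)`, the semi-unipotent
subgroup is not) and the "intricate relay between geometric and arithmetic basepoints".
-/

namespace Literature.IUT.HodgeTheaters

open CategoryTheory

universe u

namespace PMBaseKit

variable {l : ℕ} {K : PMBaseKit.{u} l} {M : K.MultKit} (FK : K.FKit M)

namespace FKit

/-! ### Definition 6.11 (i): Θ^±-bridges -/

/-- A **Θ^±-bridge** `†ψ^{Θ±}_± : †𝔉_T → †𝔉_≻` ([IUTchI] Def 6.11 (i) p. 172): "`†𝔉_≻` is an `ℱ`-prime-strip;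
`T` is an `𝔽_l^±`-group; `†𝔉_T = {†𝔉_t}_{t∈T}` is a capsule of `ℱ`-prime-strips, indexed by `T`" and a
poly-morphism "that lifts a `𝒟-Θ^±`-bridge `†φ^{Θ±}_± : †𝔇_T → †𝔇_≻` [cf. Corollary 5.3, (ii)]". The lift being
determined by the `𝒟-Θ^±`-bridge (Cor 5.3 (ii); Rmk 5.3.1), the data are the `ℱ`-prime-strips and a
`𝒟-Θ^±`-bridge structure on the associated `𝒟`-prime-strips; this rendering (here and in (ii), (iii))
presupposes Cor 5.3 (ii) (`FKit.IsomFtoDBijective`) — in a kit where lifting fails, `psi` may be empty. ([IUTchI] Def 6.11 (i) p.172) [claim: Mochizuki2012, status: disputed] -/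
structure ThetaPMBridge where
  /-- the index set `T` -/
  T : Type
  /-- finiteness -/
  [fintypeT : Fintype T]
  /-- "`T` is an `𝔽_l^±`-group" -/
  grpT : FlPMGroup l T
  /-- the capsule `†𝔉_T` -/
  capsule : FK.FCapsule T
  /-- `†𝔉_≻` -/
  codomain : FK.FStrip
  /-- the `𝒟-Θ^±`-bridge poly-morphisms `†φ^{Θ±}_t : †𝔇_t → †𝔇_≻` on the associated `𝒟`-prime-strips … -/
  dPoly : ∀ t, Set ((capsule t).assocD.Iso codomain.assocD)
  /-- … forming a `𝒟-Θ^±`-bridge (Def 6.4 (i)) -/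
  dPoly_model : ∃ (ι : ZMod l ≃ T) (_ : ∀ e ∈ grpT.charts, ι.trans e ∈ (FlPMGroup.tautological l).charts)
    (α : ∀ z, (DStrip.model K).Iso (capsule (ι z)).assocD) (β : (DStrip.model K).Iso codomain.assocD),
    ∀ z, dPoly (ι z) = DStrip.polyConj (α z) β (Ex62.poly K z)

attribute [instance] ThetaPMBridge.fintypeT

namespace ThetaPMBridge

variable {FK} (B : FK.ThetaPMBridge)

/-- The underlying `𝒟-Θ^±`-bridge `†φ^{Θ±}_± : †𝔇_T → †𝔇_≻` ([IUTchI] Def 6.11 (i) p. 172).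
([IUTchI] Def 6.11 (i) p.172) [claim: Mochizuki2012, status: disputed] -/
noncomputable def dBridge : K.DThetaPMBridge where
  T := B.T
  grpT := B.grpT
  capsule t := (B.capsule t).assocD
  codomain := B.codomain.assocD
  poly := B.dPoly
  exists_model := B.dPoly_model

/-- The poly-morphisms `†ψ^{Θ±}_t : †𝔉_t → †𝔉_≻` lifting `†φ^{Θ±}_t` ([IUTchI] Def 6.11 (i) p. 172; Rmk 5.3.1).
([IUTchI] Def 6.11 (i) p.172) [claim: Mochizuki2012, status: disputed] -/
def psi (t : B.T) : Set ((B.capsule t).Iso B.codomain) := FKit.liftPoly (B.dPoly t)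

/-- `†𝔉_{|T|}`: "the `l^±`-capsule obtained from the `l`-capsule `†𝔉_T` by forming the quotient `|T|` of the
index set … and identifying the components … indexed by the elements in the fibers of `T ↠ |T|` via
the constituent poly-morphisms of `†ψ^{Θ±}_±` [so each constituent `ℱ`-prime-strip of `†𝔉_{|T|}` is only
well-defined up to a positive automorphism …]" ([IUTchI] Def 6.11 (i) p. 172): the constituent of a
chosen representative. ([IUTchI] Def 6.11 (i) p.172) [claim: Mochizuki2012, status: disputed] -/
noncomputable def absCapsule : FK.FCapsule B.grpT.Abs := fun q => B.capsule (Quotient.out q)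

/-- `†𝔉_{T^⋇}`: "the `l^⋇`-capsule determined by the subset `T^⋇ := |T| \ {0}`" ([IUTchI] Def 6.11 (i)
p. 172). ([IUTchI] Def 6.11 (i) p.172) [claim: Mochizuki2012, status: disputed] -/
noncomputable def starCapsule : FK.FCapsule B.grpT.AbsStar := fun q => B.absCapsule q.1

/-- An **isomorphism of Θ^±-bridges**: "a pair of poly-isomorphisms `†𝔉_T ⥲ ‡𝔉_{T'}`; `†𝔉_≻ ⥲ ‡𝔉_≻` that
lifts a morphism between the associated `𝒟-Θ^±`-bridges" ([IUTchI] Def 6.11 (i) p. 172): an isomorphism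
of the underlying `𝒟-Θ^±`-bridges (the lifted poly-isomorphisms being `liftPoly` of its constituents).
([IUTchI] Def 6.11 (i) p.172) [claim: Mochizuki2012, status: disputed] -/
def Iso (B₁ B₂ : FK.ThetaPMBridge) : Type u := DThetaPMBridge.Iso B₁.dBridge B₂.dBridge

end ThetaPMBridge

/-! ### Definition 6.11 (ii): Θ^{ell}-bridges -/

/-- A **Θ^{ell}-bridge** `†ψ^{Θell}_± : †𝔉_T → †𝒟^{⊚±}` "— where `†𝒟^{⊚±}` is a category equivalent to `𝒟^{⊚±}`;
`T` is an `𝔽_l^±`-torsor; `†𝔉_T = {†𝔉_t}_{t∈T}` is a capsule of `ℱ`-prime-strips, indexed by `T` — [is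
defined] to be a `𝒟-Θ^{ell}`-bridge `†φ^{Θell}_± : †𝔇_T → †𝒟^{⊚±}` — where we write `†𝔇_T` for the capsule of
`𝒟`-prime-strips associated to `†𝔉_T`" ([IUTchI] Def 6.11 (ii) pp. 172–173).
([IUTchI] Def 6.11 (ii) p.172) [claim: Mochizuki2012, status: disputed] -/
structure ThetaEllBridge where
  /-- the index set `T` -/
  T : Type
  /-- finiteness -/
  [fintypeT : Fintype T]
  /-- "`T` is an `𝔽_l^±`-torsor" -/
  torT : FlPMTorsor l T
  /-- the capsule `†𝔉_T` of `ℱ`-prime-strips -/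
  capsule : FK.FCapsule T
  /-- `†𝒟^{⊚±}` -/
  glob : K.Glob
  /-- the `𝒟-Θ^{ell}`-bridge poly-morphisms on the associated capsule `†𝔇_T` … -/
  dPoly : ∀ t v, Set ((capsule t).assocD.obj v ⟶ (K.atV v).obj glob)
  /-- … forming a `𝒟-Θ^{ell}`-bridge (Def 6.4 (ii)) -/
  dPoly_model : ∃ (ι : ZMod l ≃ T) (_ : ∀ e ∈ torT.charts, ι.trans e ∈ (FlPMTorsor.tautological l).charts)
    (α : ∀ z, (DStrip.model K).Iso (capsule (ι z)).assocD) (β : K.gModel ≅ glob),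
    ∀ z v, dPoly (ι z) v = K.ellConj (α z) β v (Ex63.poly K z v)

attribute [instance] ThetaEllBridge.fintypeT

namespace ThetaEllBridge

variable {FK} (B : FK.ThetaEllBridge)

/-- The underlying `𝒟-Θ^{ell}`-bridge ([IUTchI] Def 6.11 (ii) p. 173).
([IUTchI] Def 6.11 (ii) p.173) [claim: Mochizuki2012, status: disputed] -/
noncomputable def dBridge : K.DThetaEllBridge where
  T := B.T
  torT := B.torT
  capsule t := (B.capsule t).assocD
  glob := B.glob
  poly := B.dPoly
  exists_model := B.dPoly_model

/-- An **isomorphism of Θ^{ell}-bridges**: "a pair of poly-isomorphisms `†𝔉_T ⥲ ‡𝔉_{T'}`; `†𝒟^{⊚±} ⥲ ‡𝒟^{⊚±}`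
that determines a morphism between the associated `𝒟-Θ^{ell}`-bridges" ([IUTchI] Def 6.11 (ii) p. 173).
([IUTchI] Def 6.11 (ii) p.173) [claim: Mochizuki2012, status: disputed] -/
def Iso (B₁ B₂ : FK.ThetaEllBridge) : Type u := DThetaEllBridge.Iso B₁.dBridge B₂.dBridge

end ThetaEllBridge

/-! ### Definition 6.11 (iii): Θ^{±ell}-Hodge theaters -/

/-- A **Θ^{±ell}-Hodge theater** `†ℋ𝒯^{Θ±ell} = (†𝔉_≻ ⟵ †𝔉_T ⟶ †𝒟^{⊚±})` ([IUTchI] Def 6.11 (iii) p. 173):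
"`†ψ^{Θ±}_±` is a Θ^±-bridge; `†ψ^{Θell}_±` is a Θ^{ell}-bridge — such that the associated data
`{†φ^{Θ±}_±, †φ^{Θell}_±}` forms a `𝒟-Θ^{±ell}`-Hodge theater" (shared `T`, shared capsule `†𝔉_T`).
([IUTchI] Def 6.11 (iii) p.173) [claim: Mochizuki2012, status: disputed] -/
structure ThetaPMEllHT where
  /-- the index set `T` -/
  T : Type
  /-- finiteness -/
  [fintypeT : Fintype T]
  /-- the `𝔽_l^±`-group structure on `T` -/
  grpT : FlPMGroup l T
  /-- the shared capsule `†𝔉_T` -/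
  capsule : FK.FCapsule T
  /-- `†𝔉_≻` -/
  codomain : FK.FStrip
  /-- `†𝒟^{⊚±}` -/
  glob : K.Glob
  /-- the `𝒟-Θ^±`-bridge poly-morphisms -/
  dPolyPM : ∀ t, Set ((capsule t).assocD.Iso codomain.assocD)
  /-- the `𝒟-Θ^{ell}`-bridge poly-morphisms -/
  dPolyEll : ∀ t v, Set ((capsule t).assocD.obj v ⟶ (K.atV v).obj glob)
  /-- "the associated data `{†φ^{Θ±}_±, †φ^{Θell}_±}` forms a `𝒟-Θ^{±ell}`-Hodge theater" (Def 6.4 (iii)) -/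
  exists_model : ∃ (ι : ZMod l ≃ T) (_ : ∀ e ∈ grpT.charts, ι.trans e ∈ (FlPMGroup.tautological l).charts)
    (α : ∀ z, (DStrip.model K).Iso (capsule (ι z)).assocD) (β : (DStrip.model K).Iso codomain.assocD)
    (γ : K.gModel ≅ glob),
    (∀ z, dPolyPM (ι z) = DStrip.polyConj (α z) β (Ex62.poly K z)) ∧
      ∀ z v, dPolyEll (ι z) v = K.ellConj (α z) γ v (Ex63.poly K z v)

attribute [instance] ThetaPMEllHT.fintypeT

namespace ThetaPMEllHT

variable {FK} (H : FK.ThetaPMEllHT)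

/-- The associated `𝒟-Θ^{±ell}`-Hodge theater ([IUTchI] Def 6.11 (iii) p. 173).
([IUTchI] Def 6.11 (iii) p.173) [claim: Mochizuki2012, status: disputed] -/
noncomputable def dHT : K.DThetaPMEllHT where
  T := H.T
  grpT := H.grpT
  capsule t := (H.capsule t).assocD
  codomain := H.codomain.assocD
  polyPM := H.dPolyPM
  glob := H.glob
  polyEll := H.dPolyEll
  exists_model := H.exists_model

/-- The Θ^±-bridge of a Θ^{±ell}-Hodge theater ([IUTchI] Def 6.11 (iii) p. 173).
([IUTchI] Def 6.11 (iii) p.173) [claim: Mochizuki2012, status: disputed] -/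
def pmBridge : FK.ThetaPMBridge where
  T := H.T
  grpT := H.grpT
  capsule := H.capsule
  codomain := H.codomain
  dPoly := H.dPolyPM
  dPoly_model := by
    obtain ⟨ι, hι, α, β, γ, h1, -⟩ := H.exists_model
    exact ⟨ι, hι, α, β, h1⟩

/-- The Θ^{ell}-bridge of a Θ^{±ell}-Hodge theater, "relative to the `𝔽_l^±`-torsor structure determined by
the `𝔽_l^±`-group structure on `T`" ([IUTchI] Def 6.11 (iii) p. 173; Def 6.4 (iii)).
([IUTchI] Def 6.11 (iii) p.173) [claim: Mochizuki2012, status: disputed] -/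
def ellBridge : FK.ThetaEllBridge where
  T := H.T
  torT := H.grpT.toTorsor
  capsule := H.capsule
  glob := H.glob
  dPoly := H.dPolyEll
  dPoly_model := by
    obtain ⟨ι, hι, α, β, γ, -, h2⟩ := H.exists_model
    exact ⟨ι, DThetaPMEllHT.indexEquiv_torsor_charts H.grpT ι hι, α, γ, h2⟩

/-- An **isomorphism of Θ^{±ell}-Hodge theaters**: "a pair of morphisms between the respective
associated Θ^±- and Θ^{ell}-bridges that are compatible with one another in the sense that they induce
the same poly-isomorphism between the respective capsules of `ℱ`-prime-strips" ([IUTchI] Def 6.11 (iii)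
p. 173): an isomorphism of the associated `𝒟-Θ^{±ell}`-Hodge theaters (the `ℱ`-level poly-isomorphisms
being the unique lifts, Cor 5.3 (ii)). ([IUTchI] Def 6.11 (iii) p.173) [claim: Mochizuki2012, status: disputed] -/
def Iso (H₁ H₂ : FK.ThetaPMEllHT) : Type u := DThetaPMEllHT.Iso H₁.dHT H₂.dHT

end ThetaPMEllHT

/-! ### Corollary 6.12; Remark 6.12.1 -/

/-- **Cor 6.12 (i)**: "The natural functorially induced map from the set of isomorphisms between two
Θ^±-bridges (respectively, two Θ^{ell}-bridges; two Θ^{±ell}-Hodge theaters) to the set of isomorphisms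
between the respective associated `𝒟-Θ^±`-bridges (respectively, associated `𝒟-Θ^{ell}`-bridges; associated
`𝒟-Θ^{±ell}`-Hodge theaters) is bijective" ([IUTchI] Cor 6.12 (i) p. 173; proof: Def 6.11 + Cor 5.3 (ii)).
In the present rendering (Def 6.11: isomorphisms of the `ℱ`-level objects ARE isomorphisms of the
associated `𝒟`-level objects, their `ℱ`-components being the unique lifts of Cor 5.3 (ii) =
`FKit.IsomFtoDBijective`) the induced map is the identity, so the printed content is absorbed into the
definitions; recorded as the (trivially PROVED) bijectivity of the canonical maps.
([IUTchI] Cor 6.12 (i) p.173) [claim: Mochizuki2012, status: disputed] -/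
theorem isomLift_bijective :
    (∀ B₁ B₂ : FK.ThetaPMBridge,
      Function.Bijective (id : ThetaPMBridge.Iso B₁ B₂ → DThetaPMBridge.Iso B₁.dBridge B₂.dBridge)) ∧
    (∀ B₁ B₂ : FK.ThetaEllBridge,
      Function.Bijective (id : ThetaEllBridge.Iso B₁ B₂ → DThetaEllBridge.Iso B₁.dBridge B₂.dBridge)) ∧
    ∀ H₁ H₂ : FK.ThetaPMEllHT,
      Function.Bijective (id : ThetaPMEllHT.Iso H₁ H₂ → DThetaPMEllHT.Iso H₁.dHT H₂.dHT) :=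
  ⟨fun _ _ => Function.bijective_id, fun _ _ => Function.bijective_id, fun _ _ => Function.bijective_id⟩

/-- **Cor 6.12 (ii)**: "Given a Θ^±-bridge and a Θ^{ell}-bridge, the set of capsule-`+`-full
poly-isomorphisms between the respective capsules of `ℱ`-prime-strips which allow one to glue the given
Θ^±- and Θ^{ell}-bridges together to form a Θ^{±ell}-Hodge theater forms a torsor over the group
`𝔽_l^{⋊±} × ({±1}^𝕍)`. Moreover, the first factor may be thought of as corresponding to the induced
isomorphisms of `𝔽_l^±`-torsors between the index sets of the capsules involved" ([IUTchI] Cor 6.12 (ii)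
p. 173: "follows immediately from Corollary 5.3, (ii); Proposition 6.6, (iv)"). In this rendering the
`ℱ`-level gluing data ARE the `𝒟`-level ones, so the statement is definitionally Prop 6.6 (iv)
(`GluingTorsor`, `PMBaseBridgeProps.lean`) for the underlying base bridges; PROVED from that named
statement, exactly as the printed proof. ([IUTchI] Cor 6.12 (ii) p.173) [claim: Mochizuki2012, status: disputed] -/
theorem gluingTorsorF (h : ∀ (B₀ : K.DThetaPMBridge) (B₀' : K.DThetaEllBridge), GluingTorsor B₀ B₀')
    (B : FK.ThetaPMBridge) (B' : FK.ThetaEllBridge) : GluingTorsor B.dBridge B'.dBridge :=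
  h _ _

/-- **Rmk 6.12.1**: "By applying Corollary 6.12, a similar remark to Remark 5.6.1 [functorial
dynamics: analogues of Propositions 4.8, (i), (ii); 4.9; 4.11] may be made concerning the Θ^±-bridges,
Θ^{ell}-bridges, and Θ^{±ell}-Hodge theaters" ([IUTchI] Rmk 6.12.1 p. 174): in the present rendering the
`ℱ`-level isomorphism sets are the `𝒟`-level ones, so every `𝒟`-level symmetry statement (Props 6.6,
6.8, 6.9) transfers verbatim — recorded as the statement that Prop 6.8 (i)'s symmetry holds for the
associated base theater of every Θ^{±ell}-Hodge theater. ([IUTchI] Rmk 6.12.1 p.174) [claim: Mochizuki2012, status: disputed] -/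
def FunctorialDynamicsPM : Prop := ∀ H : FK.ThetaPMEllHT, DThetaPMEllHT.EllBridgeSymmetry H.dHT

end FKit

/-! ### Remark 6.12.2 and Definition 6.13: gluing to ΘNF-Hodge theaters -/

namespace S5Local

variable {FK} (N : K.S5Local M FK)

/-- **Rmk 6.12.2 (i)**: a Θ-bridge `(‡𝔉_J → ‡𝔉_> ⇢ ‡ℋ𝒯^Θ)` "is glued to the Θ^±-bridge `(†𝔉_T → †𝔉_≻)` via the
functorial algorithm of Proposition 6.7" when its `𝒟-Θ`-bridge "arises as the `𝒟-Θ`-bridge associated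
[by Prop 6.7] to" the Θ^±-bridge's `𝒟-Θ^±`-bridge "[so `J = T^⋇`]" and the portion `‡𝔉_J → ‡𝔉_>` is obtained
by the similar functorial algorithm ([IUTchI] Rmk 6.12.2 (i) p. 174): for the Θ-bridge of a ΘNF-Hodge
theater (hypothesis kit `S5Local`, TODO-merge:abc-iut-L5-t3): an identification of index sets
`J ⥲ T^⋇` under which the FULL poly-isomorphisms `‡𝔉_J ⥲ †𝔉_{T^⋇}`, `‡𝔉_> ⥲ †𝔉_≻` (Def 4.6 (ii)/5.5 (ii):
isomorphisms of Θ-bridges are pairs of capsule-full / full poly-isomorphisms) are compatible with the two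
`𝒟-Θ`-bridges (the Θ-bridge's and Prop 6.7's).
([IUTchI] Rmk 6.12.2 (i) p.174) [claim: Mochizuki2012, status: disputed] -/
structure ThetaGluing (B : FK.ThetaPMBridge) (H : N.ThetaNFHT) (hl : Odd l) where
  /-- `J ⥲ T^⋇` -/
  indexEquiv : N.thJ H ≃ B.grpT.AbsStar
  /-- compatibility of the capsule-full poly-isomorphism `‡𝔉_J ⥲ †𝔉_{T^⋇}` and the full poly-isomorphism
  `‡𝔉_> ⥲ †𝔉_≻` (Def 4.6 (ii), Def 5.5 (ii): FULL poly-isomorphisms — all isomorphisms, componentwise —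
  hence no further data) with the two `𝒟-Θ`-bridges: the composite poly-morphisms
  `‡𝒟_{v_j} ⥲ †𝒟_{v_{T^⋇}} → †𝒟_{≻,v}` (through Proposition 6.7's poly-morphisms) and `‡𝒟_{v_j} → ‡𝒟_{>,v} ⥲ †𝒟_{≻,v}`
  (through the Θ-bridge's) coincide -/
  compat : ∀ j v,
    {h | ∃ (φ : ((N.thCapsule H j).assocD).obj v ≅ ((B.starCapsule (indexEquiv j)).assocD).obj v)
        (g : ((B.starCapsule (indexEquiv j)).assocD).obj v ⟶ B.codomain.assocD.obj v),
        g ∈ (B.dBridge.thetaBridgeData M hl).poly ⟨indexEquiv j⟩ v ∧ h = φ.hom ≫ g} =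
    {h | ∃ (f : ((N.thCapsule H j).assocD).obj v ⟶ (N.thFgt H).assocD.obj v)
        (ψ : (N.thFgt H).assocD.obj v ≅ B.codomain.assocD.obj v), f ∈ N.thDPoly H j v ∧ h = f ≫ ψ.hom}

/-- **Rmk 6.12.2 (ii)**: "Here, we note that by Proposition 4.8, (ii); Corollary 5.6, (ii), the gluing
isomorphism that occurs in such a gluing operation is unique" ([IUTchI] Rmk 6.12.2 (ii) p. 174; Prop 4.8
(ii): "the set of isomorphisms between two `𝒟-Θ`-bridges … is of cardinality one", an isomorphism being a
pair of a capsule-full and a full poly-isomorphism, Def 4.6 (ii)) — named statement: the gluing (index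
bijection; the poly-isomorphisms are full, hence determined) is unique.
([IUTchI] Rmk 6.12.2 (ii) p.174) [claim: Mochizuki2012, status: disputed] -/
def GluingUnique (hl : Odd l) : Prop :=
  ∀ (B : FK.ThetaPMBridge) (H : N.ThetaNFHT), Subsingleton (N.ThetaGluing B H hl)

/-- **Def 6.13 (i)**: a **Θ^{±ell}NF-Hodge theater** `†ℋ𝒯^{Θ±ellNF}` "[is] a triple, consisting of the
following data: (a) a Θ^{±ell}-Hodge theater `†ℋ𝒯^{Θ±ell}`; (b) a ΘNF-Hodge theater `†ℋ𝒯^{ΘNF}`; (c) the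
[necessarily unique!] gluing isomorphism between `†ℋ𝒯^{Θ±ell}` and `†ℋ𝒯^{ΘNF}` [cf. the discussion of
Remark 6.12.2, (i), (ii)]" ([IUTchI] Def 6.13 (i) p. 182; Rmk 6.12.2 (ii) p. 174 "by gluing a
Θ^{±ell}-Hodge theater to a ΘNF-Hodge theater along the respective associated Θ^±- and Θ-bridges via the
functorial algorithm of Proposition 6.7 … the gluing isomorphism … is unique"). The ΘNF-Hodge theater is
abc-iut-L5-t3's (hypothesis kit `S5Local` until its module lands).
([IUTchI] Def 6.13 (i) p.182) [claim: Mochizuki2012, status: disputed] -/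
structure ThetaPMEllNFHT (hl : Odd l) where
  /-- (a) the Θ^{±ell}-Hodge theater -/
  pmEll : FK.ThetaPMEllHT
  /-- (b) the ΘNF-Hodge theater -/
  thNF : N.ThetaNFHT
  /-- (c) the gluing of the Θ-bridge of (b) to the Θ^±-bridge of (a) via Proposition 6.7 -/
  gluing : N.ThetaGluing pmEll.pmBridge thNF hl

/-- **Def 6.13 (ii)**: a **`𝒟-Θ^{±ell}NF`-Hodge theater** `†ℋ𝒯^{𝒟-Θ±ellNF}` "[is] a triple, consisting of the
following data: (a) a `𝒟-Θ^{±ell}`-Hodge theater `†ℋ𝒯^{𝒟-Θ±ell}`; (b) a `𝒟-ΘNF`-Hodge theater `†ℋ𝒯^{𝒟-ΘNF}`;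
(c) the [necessarily unique!] gluing isomorphism between `†ℋ𝒯^{𝒟-Θ±ell}` and `†ℋ𝒯^{𝒟-ΘNF}`" ([IUTchI] Def
6.13 (ii) p. 183), the `𝒟-ΘNF`-Hodge theater being abc-iut-L5-t3's (here: Prop 6.7's `𝒟-Θ`-bridge data,
a global object and NF-poly-morphisms satisfying the kit predicate), the gluing identifying the
`𝒟-Θ`-bridge with Proposition 6.7's output.
([IUTchI] Def 6.13 (ii) p.183) [claim: Mochizuki2012, status: disputed] -/
structure DThetaPMEllNFHT (hl : Odd l) where
  /-- (a) the `𝒟-Θ^{±ell}`-Hodge theater -/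
  pmEll : K.DThetaPMEllHT
  /-- (b) the `𝒟-ΘNF`-Hodge theater: its global object `†𝒟^⊚` … -/
  glob : N.CatAmb
  /-- … and its `𝒟`-NF-bridge poly-morphisms on the capsule `†𝔇_{T^⋇}` of Prop 6.7's `𝒟-Θ`-bridge … -/
  nfPoly : ∀ (j : ULift pmEll.pmBridge.grpT.AbsStar) v,
    Set (((pmEll.pmBridge.thetaBridgeData M hl).capsule j).obj v ⟶ (N.nfAtV v).obj glob)
  /-- … forming, with (c) the `𝒟-Θ`-bridge glued via Proposition 6.7, a `𝒟-ΘNF`-Hodge theater -/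
  isHT : N.IsDThetaNFHT (pmEll.pmBridge.thetaBridgeData M hl) glob nfPoly

end S5Local

end PMBaseKit

end Literature.IUT.HodgeTheaters
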